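import Mathlib.NumberTheory.Harmonic.Bounds
import Mathlib.Analysis.SumIntegralComparisons
import Mathlib.Analysis.SpecialFunctions.Integrals.Basic
import Literature.NumberTheory.Sieve.LargestPrimeFactorCubicS1Decomp
import Literature.NumberTheory.Sieve.LargestPrimeFactorCubicRootPairs
import Literature.NumberTheory.Sieve.FriedlanderIwaniecPrimesGcdSums
import HarnessLib

/-!
# Heath-Brown 2001, §5: the counting estimates behind "`S₁ ≪ X^{1−ε}`"

Sixteenth proved layer of this seat under the named fact `HeathBrown2001_largestPrimeFactor_cubic`
(`LargestPrimeFactorCubic.lean`; D. R. Heath-Brown, *The largest prime factor of `X³ + 2`*, Proc.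
London Math. Soc. (3) 82 (2001) 554–596).  The final bookkeeping of §5 (pp. 572–573) uses, besides
Theorem 2, only elementary counting facts, which this file PROVES in explicit form:

* `card_roots_prime_le_three`, `card_roots_mul_le`, `card_roots_le_three_pow` — the number of
  cube roots of `2` modulo a squarefree `e` is `≤ 3^{ω(e)}` (the `ρ(K) = 1` count of the `K ∈ 𝒦`
  above each rational prime, (2.4)) (with `3^{ω(n)} ≤ d(n)²`, `HeathBrown2001.three_pow_card_primeFactors_le_sq`
  of `…RootPairs`);
* "`∑_{n≤x} (q, n) ≤ ∑_{k∣q} k #{n ≤ x : k ∣ n} ≤ x d(q)`" (p. 572) is `FriedlanderIwaniecPrimes.sum_gcd_le`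
  of `…FriedlanderIwaniecPrimesGcdSums` (reused, not restated), and
  `sum_gcd_div_le` — `∑_{ν≤V} (q, ν)/ν ≤ d(q)(1 + log V)`;
* `card_scales_le` — the number of generator cubes is `≤ (δ/(6 log(20/19))) log X + 1`;
* `sum_Icc_rpow_neg_le` — `∑_{n≤x} n^{−φ} ≤ 1 + x^{1−φ}/(1−φ)` for `0 < φ < 1` (the sums
  `∑_{K}∑_{A}(N/N(KA))^φ ≪ X^{7δ}(N/X^{7δ})^φ`, p. 573).

## References

* D. R. Heath-Brown, *The largest prime factor of `X³ + 2`*, Proc. London Math. Soc. (3) 82 (2001)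
  554–596, §5 pp. 572–573, (2.4)–(2.5). [`HeathBrown2001LargestPrimeFactorCubic`]
-/

noncomputable section

open Finset Real Polynomial

namespace Literature.NumberTheory.Sieve.LargestPrimeFactorCubic

/-! ### Cube roots of `2` modulo squarefree `e` -/

/-- **Lagrange**: `#roots(p) ≤ 3` for `p` prime (`X³ − 2` has at most three roots in `𝔽_p`).
[folklore] -/
theorem card_roots_prime_le_three {p : ℕ} (hp : p.Prime) : #(roots p) ≤ 3 := by
  classical
  haveI := Fact.mk hp
  set Φ : (ZMod p)[X] := X ^ 3 - C 2 with hΦ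
  have hΦ0 : Φ ≠ 0 := (monic_X_pow_sub_C (2 : ZMod p) three_ne_zero).ne_zero
  have heval : ∀ r : ℕ, (p : ℤ) ∣ (r : ℤ) ^ 3 - 2 → Φ.IsRoot (r : ZMod p) := by
    intro r hr
    have h0 : (((r : ℤ) ^ 3 - 2 : ℤ) : ZMod p) = 0 := (ZMod.intCast_zmod_eq_zero_iff_dvd _ _).mpr hr
    push_cast at h0
    simpa [IsRoot.def, hΦ] using h0
  calc #(roots p) ≤ #Φ.roots.toFinset := by
        refine card_le_card_of_injOn (fun r => (r : ZMod p)) (fun r hr => ?_) ?_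
        · rw [mem_coe, roots, mem_filter] at hr
          rw [mem_coe, Multiset.mem_toFinset, mem_roots hΦ0]
          exact heval r hr.2
        · intro r hr r' hr' h
          rw [mem_coe, roots, mem_filter, mem_range] at hr hr'
          have h' : r % p = r' % p := (ZMod.natCast_eq_natCast_iff' r r' p).1 h
          rwa [Nat.mod_eq_of_lt hr.1, Nat.mod_eq_of_lt hr'.1] at h'
    _ ≤ Multiset.card Φ.roots := Multiset.toFinset_card_le _
    _ ≤ Φ.natDegree := card_roots' Φ
    _ = 3 := by rw [hΦ]; exact natDegree_X_pow_sub_C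

/-- **CRT**: `#roots(mn) ≤ #roots(m) · #roots(n)` for coprime `m, n ≥ 1` (the map
`j ↦ (j mod m, j mod n)` is injective). [folklore] -/
theorem card_roots_mul_le {m n : ℕ} (hm : 0 < m) (hn : 0 < n) (hmn : Nat.Coprime m n) :
    #(roots (m * n)) ≤ #(roots m) * #(roots n) := by
  classical
  rw [← card_product]
  refine card_le_card_of_injOn (fun j => (j % m, j % n)) (fun j hj => ?_) ?_
  · rw [mem_coe, roots, mem_filter, mem_range] at hj
    rw [mem_coe, mem_product]
    have hred : ∀ k : ℕ, 0 < k → (k : ℤ) ∣ ((m * n : ℕ) : ℤ) → j % k ∈ roots k := by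
      intro k hk hkd
      rw [roots, mem_filter, mem_range]
      refine ⟨Nat.mod_lt _ hk, ?_⟩
      have h1 : (k : ℤ) ∣ (j : ℤ) ^ 3 - 2 := hkd.trans hj.2
      have h2 : (k : ℤ) ∣ (j : ℤ) - (j % k : ℕ) := by
        rw [Int.natCast_mod]
        exact (Int.mod_modEq (j : ℤ) k).dvd
      have h3 : (k : ℤ) ∣ (j : ℤ) ^ 3 - ((j % k : ℕ) : ℤ) ^ 3 := h2.trans (sub_dvd_pow_sub_pow _ _ 3)
      have := dvd_sub h1 h3
      rwa [show (j : ℤ) ^ 3 - 2 - ((j : ℤ) ^ 3 - ((j % k : ℕ) : ℤ) ^ 3) = ((j % k : ℕ) : ℤ) ^ 3 - 2 by ring] at this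
    exact ⟨hred m hm (by push_cast; exact dvd_mul_right _ _), hred n hn (by push_cast; exact dvd_mul_left _ _)⟩
  · intro j hj j' hj' h
    rw [mem_coe, roots, mem_filter, mem_range] at hj hj'
    simp only [Prod.mk.injEq] at h
    have h1 : j ≡ j' [MOD m] := h.1
    have h2 : j ≡ j' [MOD n] := h.2
    have h12 : j ≡ j' [MOD m * n] := (Nat.modEq_and_modEq_iff_modEq_mul hmn).1 ⟨h1, h2⟩
    exact Nat.ModEq.eq_of_lt_of_lt h12 hj.1 hj'.1

/-- **`#roots(e) ≤ 3^{ω(e)}` for squarefree `e`**: at most three first-degree primes of `ℚ(∛2)` above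
each rational prime ((2.4), `ρ(K) = 1`). [cite: HeathBrown2001LargestPrimeFactorCubic, (2.4)] -/
theorem card_roots_le_three_pow {e : ℕ} (he : Squarefree e) : #(roots e) ≤ 3 ^ e.primeFactors.card := by
  classical
  -- induction over the set of prime factors, `e = ∏ primeFactors`
  have key : ∀ s : Finset ℕ, (∀ p ∈ s, p.Prime) → #(roots (∏ p ∈ s, p)) ≤ 3 ^ s.card := by
    intro s
    induction s using Finset.induction_on with
    | empty =>
        intro _
        simp only [prod_empty, card_empty, pow_zero]
        -- `roots 1 = {0}`
        rw [roots]
        exact (card_filter_le _ _).trans (by simp)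
    | @insert p s hps ih =>
        intro hprime
        have hp : p.Prime := hprime p (mem_insert_self p s)
        have hs : ∀ q ∈ s, q.Prime := fun q hq => hprime q (mem_insert_of_mem hq)
        rw [prod_insert hps, card_insert_of_notMem hps, pow_succ']
        have hcop : Nat.Coprime p (∏ q ∈ s, q) := by
          refine Nat.Coprime.prod_right (fun q hq => ?_)
          exact (Nat.coprime_primes hp (hs q hq)).2 (fun h => hps (h ▸ hq))
        have hpos : 0 < ∏ q ∈ s, q := prod_pos (fun q hq => (hs q hq).pos)
        calc #(roots (p * ∏ q ∈ s, q)) ≤ #(roots p) * #(roots (∏ q ∈ s, q)) :=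
              card_roots_mul_le hp.pos hpos hcop
          _ ≤ 3 * 3 ^ s.card := Nat.mul_le_mul (card_roots_prime_le_three hp) (ih hs)
  have := key e.primeFactors (fun p hp => Nat.prime_of_mem_primeFactors hp)
  rwa [Nat.prod_primeFactors_of_squarefree he] at this

/-! ### Sums of `gcd`s -/

/-- **`∑_{ν ≤ V} (ν, q)/ν ≤ d(q)(1 + log V)`** (`= ∑_{k∣q} ∑_{m ≤ V/k} 1/m`). [folklore] -/
theorem sum_gcd_div_le {q : ℕ} (hq : q ≠ 0) (V : ℕ) :
    ∑ ν ∈ Icc 1 V, (Nat.gcd ν q : ℝ) / ν ≤ #q.divisors * (1 + Real.log V) := by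
  have hharm : ∀ n : ℕ, ∑ m ∈ Icc 1 n, (1 : ℝ) / m ≤ 1 + Real.log V ∨ V < n := by
    intro n
    rcases le_or_gt n V with h | h
    · left
      rcases Nat.eq_zero_or_pos n with hn | hn
      · subst hn; simp; positivity
      have h1 : ∑ m ∈ Icc 1 n, (1 : ℝ) / m = (harmonic n : ℝ) := by
        rw [harmonic_eq_sum_Icc]; push_cast; simp [one_div]
      rw [h1]
      have hlog : Real.log n ≤ Real.log V := Real.log_le_log (by exact_mod_cast hn) (by exact_mod_cast h)
      linarith [harmonic_le_one_add_log n]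
    · right; exact h
  calc ∑ ν ∈ Icc 1 V, (Nat.gcd ν q : ℝ) / ν
      ≤ ∑ ν ∈ Icc 1 V, ∑ k ∈ q.divisors.filter (· ∣ ν), (k : ℝ) / ν := by
        refine sum_le_sum (fun ν hν => ?_)
        rw [← sum_div]
        exact div_le_div_of_nonneg_right (FriedlanderIwaniecPrimes.gcd_le_sum_divisors hq ν) (Nat.cast_nonneg ν)
    _ = ∑ k ∈ q.divisors, ∑ ν ∈ (Icc 1 V).filter (fun ν => k ∣ ν), (k : ℝ) / ν := by
        rw [sum_comm' (t' := q.divisors) (s' := fun k => (Icc 1 V).filter (fun ν => k ∣ ν))]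
        intro ν k
        simp only [mem_filter]
        tauto
    _ ≤ ∑ k ∈ q.divisors, (1 + Real.log V) := by
        refine sum_le_sum (fun k hk => ?_)
        have hk0 : 0 < k := Nat.pos_of_mem_divisors hk
        -- reindex `ν = k m`, `m ≤ V / k`
        have hsub : (Icc 1 V).filter (fun ν => k ∣ ν) = (Icc 1 (V / k)).image (fun m => k * m) := by
          ext ν
          simp only [mem_filter, mem_Icc, mem_image]
          constructor
          · rintro ⟨⟨h1, h2⟩, m, rfl⟩
            refine ⟨m, ⟨?_, ?_⟩, rfl⟩
            · rcases Nat.eq_zero_or_pos m with hm | hm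
              · subst hm; simp at h1
              · exact hm
            · exact (Nat.le_div_iff_mul_le hk0).2 (by rw [mul_comm]; exact h2)
          · rintro ⟨m, ⟨h1, h2⟩, rfl⟩
            refine ⟨⟨Nat.mul_pos hk0 h1, ?_⟩, dvd_mul_right _ _⟩
            have := (Nat.le_div_iff_mul_le hk0).1 h2
            rw [mul_comm]; exact this
        rw [hsub, sum_image (fun m _ m' _ h => Nat.eq_of_mul_eq_mul_left hk0 h)]
        have hterm : ∀ m ∈ Icc 1 (V / k), (k : ℝ) / ((k * m : ℕ) : ℝ) = 1 / m := by
          intro m hm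
          rw [mem_Icc] at hm
          have hk' : (k : ℝ) ≠ 0 := by exact_mod_cast hk0.ne'
          have hm' : (m : ℝ) ≠ 0 := by exact_mod_cast (Nat.pos_iff_ne_zero.1 hm.1)
          push_cast
          field_simp
        rw [sum_congr rfl hterm]
        rcases hharm (V / k) with h | h
        · exact h
        · exact absurd (Nat.div_le_self V k) (not_le.2 h)
    _ = #q.divisors * (1 + Real.log V) := by rw [sum_const, nsmul_eq_mul]

/-! ### The number of cubes -/

/-- **The number of generator cubes is `O(log X)`**: `#scales(X) ≤ (δ/(6 log(20/19))) log X + 1`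
(`(19/20)^{3i} ≥ X^{−δ/2}/0.93` for `i ∈ scales`). [folklore] -/
theorem card_scales_le {X : ℕ} (hX : 1 ≤ X) :
    (#(scales X) : ℝ) ≤ hbδ / (6 * Real.log (20 / 19)) * Real.log X + 1 := by
  have hlog : 0 < Real.log (20 / 19) := Real.log_pos (by norm_num)
  have hX1 : (1 : ℝ) ≤ X := by exact_mod_cast hX
  have hlogX : 0 ≤ Real.log X := Real.log_nonneg hX1
  set bnd : ℝ := hbδ / (6 * Real.log (20 / 19)) * Real.log X with hbnd
  have hbnd0 : 0 ≤ bnd := by rw [hbnd]; exact mul_nonneg (div_nonneg hbδ_pos.le (by positivity)) hlogX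
  -- every `i ∈ scales` satisfies `i ≤ bnd`
  have hi : ∀ i ∈ scales X, (i : ℝ) ≤ bnd := by
    intro i hi
    have h := mem_scales hi
    rw [tscale, mul_pow, Npar, ← Real.rpow_natCast, ← Real.rpow_mul (by positivity)] at h
    have e1 : (1 + 2 * hbδ) / 3 * ((3 : ℕ) : ℝ) = 1 + 2 * hbδ := by push_cast; ring
    rw [e1] at h
    -- `X^{1+3δ/2} ≤ 0.93 X^{1+2δ} (19/20)^{3i}` ⇒ `(20/19)^{3i} ≤ 0.93 X^{δ/2}` ⇒ logs
    have hXpos : (0 : ℝ) < X := by positivity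
    have h2 : (X : ℝ) ^ (1 + 3 * hbδ / 2) = (X : ℝ) ^ (1 + 2 * hbδ) * (X : ℝ) ^ (-(hbδ / 2)) := by
      rw [← Real.rpow_add hXpos]; ring_nf
    rw [h2] at h
    have hXp : (0 : ℝ) < (X : ℝ) ^ (1 + 2 * hbδ) := by positivity
    have h3 : (X : ℝ) ^ (-(hbδ / 2)) ≤ 93 / 100 * ((19 / 20 : ℝ) ^ i) ^ (3 : ℕ) := by
      have := h
      nlinarith [hXp, this]
    -- take logs
    have hpos19 : (0 : ℝ) < ((19 / 20 : ℝ) ^ i) ^ (3 : ℕ) := by positivity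
    have h4 := Real.log_le_log (by positivity) h3
    rw [Real.log_rpow hXpos, Real.log_mul (by norm_num) hpos19.ne', Real.log_pow, Real.log_pow] at h4
    have hlog93 : Real.log (93 / 100) < 0 := Real.log_neg (by norm_num) (by norm_num)
    have hl : Real.log (19 / 20 : ℝ) = -Real.log (20 / 19) := by
      rw [← Real.log_inv]; norm_num
    rw [hl] at h4
    push_cast at h4
    -- `−(δ/2) log X ≤ log 0.93 − 3 i log(20/19)` ⇒ `i ≤ (δ/2) log X/(3 log(20/19))`
    rw [hbnd]
    rw [div_mul_eq_mul_div, le_div_iff₀ (by positivity)]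
    nlinarith
  -- hence `scales ⊆ range (⌊bnd⌋ + 1)`
  have hsub : scales X ⊆ range (⌊bnd⌋₊ + 1) := by
    intro i hi'
    rw [mem_range]
    have := hi i hi'
    have : i ≤ ⌊bnd⌋₊ := Nat.le_floor this
    omega
  calc (#(scales X) : ℝ) ≤ #(range (⌊bnd⌋₊ + 1)) := by exact_mod_cast card_le_card hsub
    _ = ⌊bnd⌋₊ + 1 := by rw [card_range]; push_cast; ring
    _ ≤ bnd + 1 := by linarith [Nat.floor_le hbnd0]

/-! ### `∑ n^{−φ}` -/

/-- `∑_{n=1}^{x} n^{−φ} ≤ 1 + x^{1−φ}/(1 − φ)` for `0 < φ < 1`. [folklore] -/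
theorem sum_Icc_rpow_neg_le {φ : ℝ} (hφ0 : 0 < φ) (hφ1 : φ < 1) (x : ℕ) :
    ∑ n ∈ Icc 1 x, (n : ℝ) ^ (-φ) ≤ 1 + (x : ℝ) ^ (1 - φ) / (1 - φ) := by
  rcases Nat.eq_zero_or_pos x with hx | hx
  · subst hx; simp; positivity
  -- split off `n = 1` and compare the rest with `∫_1^x u^{−φ} du`
  have hsplit : ∑ n ∈ Icc 1 x, (n : ℝ) ^ (-φ) = 1 + ∑ i ∈ Ico 1 x, ((i + 1 : ℕ) : ℝ) ^ (-φ) := by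
    rw [Finset.Icc_eq_cons_Ioc hx, sum_cons]
    simp only [Nat.cast_one, Real.one_rpow]
    congr 1
    rw [show Ioc 1 x = (Ico 1 x).image (· + 1) by
      ext n; simp only [mem_Ioc, mem_image, mem_Ico]; constructor
      · intro h; exact ⟨n - 1, by omega, by omega⟩
      · rintro ⟨m, hm, rfl⟩; omega]
    rw [sum_image (fun a _ b _ h => by simpa using h)]
  rw [hsplit]
  have hanti : AntitoneOn (fun u : ℝ => u ^ (-φ)) (Set.Icc ((1 : ℕ) : ℝ) x) := by
    intro u hu v _ huv
    have hu1 : (0 : ℝ) < u := by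
      have := hu.1; push_cast at this; linarith
    exact Real.rpow_le_rpow_of_nonpos hu1 huv (by linarith)
  have hint := AntitoneOn.sum_le_integral_Ico (by exact_mod_cast hx) hanti
  have h1φ : 0 < 1 - φ := by linarith
  have hI : ∫ u in ((1 : ℕ) : ℝ)..((x : ℕ) : ℝ), u ^ (-φ) = ((x : ℝ) ^ (1 - φ) - 1) / (1 - φ) := by
    push_cast
    rw [integral_rpow (Or.inr ⟨by linarith, ?_⟩)]
    · rw [Real.one_rpow, show -φ + 1 = 1 - φ by ring]
    · rw [Set.uIcc_of_le (by exact_mod_cast hx)]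
      simp only [Set.mem_Icc, not_and, not_le]
      intro h; linarith
  rw [hI] at hint
  have hmono : ((x : ℝ) ^ (1 - φ) - 1) / (1 - φ) ≤ (x : ℝ) ^ (1 - φ) / (1 - φ) :=
    div_le_div_of_nonneg_right (by linarith) h1φ.le
  linarith

end Literature.NumberTheory.Sieve.LargestPrimeFactorCubic
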